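import Summits.BirchSwinnertonDyer.BirchSwinnertonDyer.Theorems.ClassRecordThreeShimuraKolyvaginOrderBoundAtThreeSurjOrderEntry
import Summits.BirchSwinnertonDyer.BirchSwinnertonDyer.Theorems.ClassRecordThreeShimuraKolyvaginOrderBoundAtThreeSurjOrderReciprocity
import Summits.BirchSwinnertonDyer.BirchSwinnertonDyer.Theorems.ErratumRoadFiveShimuraKolyvaginOrderBoundInertReciprocity
import Summits.BirchSwinnertonDyer.Rank1Residual.Additive.X4RankZeroLowerKolyvaginIndexForm
import HarnessLib

/-!
# Cruxes `ShimuraKolyvaginOrderBoundInertFromFive` (item stmt-BirchSwinnertonDyer-19718, S2 `stub_inert_divisibleIndex`)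
# and `ShimuraKolyvaginOrderBoundAtFive`-type twins (item 19627) — the `p ≥ 5` END of the conductor-keyed ORDER machine:
# `#Ш(E/K)[p^∞] ≤ p^(2·ord_p[E(K):ℤP])` modulo the ring-class-rational carrier, Poitou–Tate and the Cassels–Tate inputs

Cell `bsd-stepL` (run/shared/lean/pub/bsd-stepL/), seat `bsd-stepL-shim3a` (prover g2; the `p ≥ 5` reading of its
`p = 3` END `…SurjOrderEnd.lean` for crux 19899), HELPER for item stmt-BirchSwinnertonDyer-19718
(`--supports stmt-BirchSwinnertonDyer-19718 --as helper`; route `ErratumRoadFive`, skeleton v2 df9d5864: S1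
`stub_inert_unitIndex` ∕ S2 `stub_inert_divisibleIndex`). shim-p1 g7 reduced S1 (m₀ = 0) to {carrier, PT, hTam,
0 < index} (`…InertReciprocity` p471634, LOCAL-HALF-19718.md §2) and listed S2 as «the same re-key applies to x11b3's
ORDER machine … ≈ 1 session of statement-copying» (§3). That re-key is this seat's `…SurjOrder{CTValue,Reciprocity,
Leaves,Bound,Sha,Hloc,AtPrime,Entry}` series (p-generic); this file composes it with shim-p1's `p ≥ 5` local leaf.

## What this file proves

* `card_sha_primary_le_of_ringClassRationalPointsM_of_poitouTate_of_localDuality_of_five_le` — McCallum 1991 §1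
  Theorem (Kolyvagin), ORDER form, `p ≥ 5`, `ρ̄_{E,p}` onto, for `hpointsR`-data: `Ш(E/K)[p^∞]` finite, killed by
  `p^{M₀}`, `#Ш ≤ p^{2M₀}`, `ord_p ≤ 2M₀` (`p^{M₀} x₀ = P ∉ p^{M₀+1}E(K)`, `M₀ ≥ 1`).
* `natCard_sha_primary_le_pow_index_of_ringClassRationalPointsM_of_poitouTate_of_localDuality_of_five_le` — S1 + S2 in
  the items' own INDEX form: `Nat.card (primaryComponent (W.baseChange K).sha p) ≤ p ^ (2 * padicValNat p (zmultiples P).index)`.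

## Honest framing

THEOREMS ONLY (no `def`, no named fact, no `sorry`; axioms standard). CONDITIONAL on (a) `hpointsR` (the Shimura CM-point
carrier, port in progress: shim-p1 p475855 ∕ p476190, LOCAL-HALF-19718 §6), (b) `hPT`, (c) `hTam` (NOT a clause of item
19718 as typed — planner's HELD ruling 21:38Z; the shift leaf `…_of_ringClassRational_shift` (p477215) removes it for data
one level deeper, pending the deep Čebotarev supply), (d) the machine's Cassels–Tate inputs, (e) `0 < index`; the items'
data `Dt X W' P₀ degS` + display unused. Items 19718 ∕ 19627 stay OPEN. BSD is not proved by any of this.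

## References

[cite: McCallumLMS1991, §1 Theorem (Kolyvagin), Lemma 5.1, §§4–5, Cor. 5.6] [cite: GrossLMS1991, §2 Prop. 2.1 (2), Thm. 2.2 (2)]
[cite: BertoliniDarmon1996, §2.3–2.6, Prop. 2.6] [cite: Nekovar2007, (4.8)–(4.13)] [cite: Kim2022HigherGZ, §2.1 and Thm. 4.3]
[cite: MilneADT2006, Ch. I Prop. 3.8, Thm. 4.10(b), §6 Thm. 6.13(a)] [cite: SilvermanAEC2009, Thm. VII.6.1]
presearch: the order bound on X_{N⁺,N⁻} at p ∣ N⁺, p ≥ 5 → statement printed (Kim 2024 Thm 4.3, JSW17 4.4.1), proof by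
citation only (D-AUDIT-19526c4 §0 K2 annex, Table C rows C11–C12; corpus + galaxy); tree `lean search 'of_localDuality_of_five_le'` → none.
-/

noncomputable section

open scoped Classical AddSubgroup
set_option linter.dupNamespace false
namespace Summit.BirchSwinnertonDyer.BirchSwinnertonDyer.Theorems.ShimuraKolyvaginLocalShift

open WeierstrassCurve NumberField IsDedekindDomain Field Function
  Literature.NumberTheory.EllipticCurves Literature.NumberTheory.EllipticCurves.KolyvaginCocycle
  Literature.NumberTheory.EllipticCurves.KolyvaginDescent
  Literature.NumberTheory.EllipticCurves.RingClassField
  Literature.NumberTheory.GaloisRepresentations Literature.NumberTheory.GaloisCohomology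
  Literature.NumberTheory.NumberFields Literature.NumberTheory.DiophantineGeometry
  Summit.BirchSwinnertonDyer.BirchSwinnertonDyer.Theorems
  Summit.BirchSwinnertonDyer.BirchSwinnertonDyer.Theorems.ShimuraKolyvaginOrder
open Literature.NumberTheory.GaloisRepresentations.DiscreteGaloisModule (mu MuCarrier)

-- Cup products need `LocallyCompactSpace Γ_K`; as in the tree's Cassels–Tate files.
attribute [local instance] absoluteGaloisGroup_compactSpace

-- `CharZero` of the completions (the Cassels–Tate local terms), as in the tree's files.
attribute [local instance] charZero_placeCompletion

variable {K : Type} [Field K] [NumberField K]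

/-- **McCallum 1991 §1 Theorem (Kolyvagin), ORDER form, at an odd prime `p ≥ 5` with `ρ̄_{E,p}` onto, for a
Heegner-type Euler system rational over the ring class fields, from Poitou–Tate and the Cassels–Tate inputs** — the
`p ≥ 5` twin of this seat's `card_sha_three_primary_le_…` (S2 `stub_inert_divisibleIndex` of item 19718 ∕ item 19627
over the machine): for `p^{M₀} x₀ = P ∉ p^{M₀+1}E(K)`, `M₀ ≥ 1`: `Ш(E/K)[p^∞]` finite, killed by `p^{M₀}`, of order
`≤ p^{2M₀}`, `ord_p ≤ 2M₀` — GRANTED `hpointsR` (binder VERBATIM from shim-p1's `…InertMachineEntry` §4), `hPT`,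
shim-p1's ℚ-side Tamagawa clause `hTam` (option (ii) of S1S2-ROAD-19718 §2) and the Cassels–Tate inputs. Proof: the
conductor-keyed entry with clause (d) from shim-p1's `kolyvaginClass_mem_selmerLocalKer_of_ringClassRational_of_isKolyvaginPrime`
(p469959) and `hRT` from `kolyvaginReciprocityFinset_of_poitouTate_of_conductorNorm`.
[cite: McCallumLMS1991, §1 Theorem (Kolyvagin), Cor. 5.6] [cite: GrossLMS1991, §2 Thm. 2.2 (2)]
[cite: MilneADT2006, Ch. I Thm. 4.10(b), §6 Thm. 6.13(a)] [cite: Kim2022HigherGZ, §2.1 and Thm. 4.3] -/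
theorem card_sha_primary_le_of_ringClassRationalPointsM_of_poitouTate_of_localDuality_of_five_le
    (hPT : poitouTate_sum_localTatePairing_eq_zero K)
    (W : WeierstrassCurve ℚ) [W.IsElliptic] [W.IsGloballyMinimal] {N : ℕ} [NeZero N]
    (hN : W.conductorNorm ℤ = N) {p : ℕ} [Fact p.Prime] (hp5 : 5 ≤ p) (hρ : W.HasSurjectiveModNGaloisRep p)
    (hK : IsImaginaryQuadratic K)
    (ι : K →+* ℂ) {S : Finset ℕ}
    (hin : ∀ ℓ ∈ S, ℓ.Prime ∧ ℓ ∣ N ∧ ¬ ℓ ^ 2 ∣ N ∧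
      ((Ideal.span {(ℓ : ℤ)}).primesOver (𝓞 K)).ncard = 1 ∧ ¬ (ℓ : ℤ) ∣ NumberField.discr K)
    (hsp : ∀ ℓ : ℕ, ℓ.Prime → ℓ ∣ N → ℓ ∉ S → ((Ideal.span {(ℓ : ℤ)}).primesOver (𝓞 K)).ncard = 2)
    (hTam : ∀ (ℓ : ℕ) [Fact ℓ.Prime], ℓ ∉ S → W.HasMultiplicativeReductionAtPrime ℓ →
      ¬ p ∣ padicValInt ℓ W.minimalDiscriminantInt)
    {P : (W.baseChange K).toAffine.Point} (hnt : ¬ IsOfFinAddOrder P)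
    {M₀ : ℕ} (hM₀ : 1 ≤ M₀) [NeZero (p ^ M₀)] {c : K ≃ₐ[ℚ] K} (hc : c ≠ 1) (hcc : c * c = 1)
    {x₀ : (W.baseChange K).toAffine.Point} (hx₀ : p ^ M₀ • x₀ = P)
    (hmax : ∀ Q : (W.baseChange K).toAffine.Point, p ^ (M₀ + 1) • Q ≠ P)
    (hpointsR : ∀ {M : ℕ} (_hM : 1 ≤ M)
      (hdiv : ∀ Q : geomPoints (W.baseChange K), ∃ R, ((p ^ M : ℕ) : ℤ) • R = Q)
      (c : K ≃ₐ[ℚ] K) (_hc : c ≠ 1),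
      ∃ (ε : ℤ) (τ : AlgebraicClosure K ≃+* AlgebraicClosure K) (hτ : IsLiftOfAut c τ)
        (A : ℕ → AddSubgroup (geomPoints (W.baseChange K)))
        (hA : ∀ m, KolyvaginCocycle.IsAdmissible (Field.absoluteGaloisGroup K) (A m)
          ((p ^ M : ℕ) : ℤ))
        (emb : ∀ m : ℕ, ringClassField K ι m →ₐ[K] AlgebraicClosure K)
        (Pt : ℕ → geomPoints (W.baseChange K))
        (hPt : ∀ m, Pt m ∈
          KolyvaginCocycle.invPoints (Field.absoluteGaloisGroup K) (A m) ((p ^ M : ℕ) : ℤ)),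
        (ε = 1 ∨ ε = -1) ∧
        IsOfFinAddOrder (Affine.Point.map (W' := W) (c : K →ₐ[ℚ] K) P - ε • P) ∧
        (∀ m, ∀ a ∈ A m, hτ.pointsMap W a ∈ A m) ∧
        Pt 1 = toGeomPoints (W.baseChange K) P ∧
        (∀ m, m ≠ 0 → ∀ a ∈ A m, ∀ Φ : Field.absoluteGaloisGroup K,
          (∀ x : ringClassField K ι m, Φ • emb m x = emb m x) → Φ • a = a) ∧
        (∀ m : ℕ, Squarefree m →
          (∀ q ∈ m.primeFactors, IsKolyvaginPrime N W K p q ∧ FrobEqFrobInfty W K (p ^ M) q) →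
          (∃ B ∈ A m, hτ.pointsMap W (Pt m) =
            (ε * (-1) ^ m.primeFactors.card) • Pt m + ((p ^ M : ℕ) : ℤ) • B) ∧
          (∀ ℓ : ℕ, ℓ.Prime → ℓ ∣ m → ∀ v : HeightOneSpectrum (𝓞 K), (ℓ : 𝓞 K) ∈ v.asIdeal →
            ∀ a : ℕ, (((p : ℤ) ^ a) •
                kolyvaginClass (W.baseChange K) _ hdiv (hA m) (Pt m) (hPt m) ∈
                selmerLocalKer (W.baseChange K) (v.adicCompletion K) ((p ^ M : ℕ) : ℤ) ↔
              ((p : ℤ) ^ a) • kolyvaginClass (W.baseChange K) _ hdiv (hA (m / ℓ)) (Pt (m / ℓ))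
                  (hPt (m / ℓ)) ∈
                (W.baseChange K).torsionLocalKer (v.adicCompletion K) ((p ^ M : ℕ) : ℤ)))))
    (e : geomTorsion (W.baseChange K) ((p ^ M₀ * p ^ M₀ : ℕ) : ℤ) →
      geomTorsion (W.baseChange K) ((p ^ M₀ * p ^ M₀ : ℕ) : ℤ) → AlgebraicClosure K)
    (hμ : ∀ S T, e S T ^ (p ^ M₀ * p ^ M₀) = 1)
    (hadd₁ : ∀ S₁ S₂ T, e (S₁ + S₂) T = e S₁ T * e S₂ T)
    (hadd₂ : ∀ S T₁ T₂, e S (T₁ + T₂) = e S T₁ * e S T₂)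
    (hgal : ∀ (σ : absoluteGaloisGroup K) (S T : geomTorsion (W.baseChange K) ((p ^ M₀ * p ^ M₀ : ℕ) : ℤ)),
      σ • e S T = e (σ • S) (σ • T))
    (halt : ∀ T, e T T = 1) (hnondeg : ∀ T, (∀ S, e S T = 1) → T = 0)
    (inv : LocalInvariants K (p ^ M₀ * p ^ M₀)) (hPT' : inv.SumInvLocalizationEqZero)
    (hinv : ∀ v : HeightOneSpectrum (𝓞 K), Injective (inv (Sum.inr v)))
    (hH3 : ∀ x : galoisCohomology (mu K (p ^ M₀ * p ^ M₀)) 3,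
      (∀ v : Place K, galoisCohomology.localization (mu K (p ^ M₀ * p ^ M₀)) v 3 x = 0) → x = 0)
    (hB : Literature.GroupTheory.FiniteAbelian.IsLevelPairing (p ^ M₀)
      (ctLevelPairing (W.baseChange K) (p ^ M₀) e hμ hadd₁ hadd₂ hgal inv halt hPT' hH3
        (localTerm_finite_support (W := W.baseChange K) (m := p ^ M₀) (e := e) (hμ := hμ)
          (hadd₁ := hadd₁) (hadd₂ := hadd₂) (hgal := hgal) halt inv)))
    (hPτ : ∀ z ∈ selmerGroup (W.baseChange K) ((p ^ M₀ * p ^ M₀ : ℕ) : ℤ),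
      ∀ t ∈ selmerGroup (W.baseChange K) ((p ^ M₀ * p ^ M₀ : ℕ) : ℤ),
      ctGeneralFun (W.baseChange K) (p ^ M₀) e hμ hadd₁ hadd₂ hgal inv
          (torsionH1ToH1 (W.baseChange K) _ (conjAct W c _ z))
          (torsionH1ToH1 (W.baseChange K) _ (conjAct W c _ t)) =
        ctGeneralFun (W.baseChange K) (p ^ M₀) e hμ hadd₁ hadd₂ hgal inv
          (torsionH1ToH1 (W.baseChange K) _ z) (torsionH1ToH1 (W.baseChange K) _ t)) :
    Finite (AddCommGroup.primaryComponent (W.baseChange K).sha p) ∧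
    (∀ c ∈ AddCommGroup.primaryComponent (W.baseChange K).sha p, p ^ M₀ • c = 0) ∧
    Nat.card (AddCommGroup.primaryComponent (W.baseChange K).sha p) ≤ p ^ (2 * M₀) ∧
    padicValNat p (Nat.card (AddCommGroup.primaryComponent (W.baseChange K).sha p)) ≤ 2 * M₀ := by
  haveI : (W.baseChange K).IsElliptic := inferInstanceAs (W.map (algebraMap ℚ K)).IsElliptic
  have hp : p.Prime := Fact.out
  refine card_sha_primary_le_at_of_pointsM_of_reciprocityFinset_of_localDuality_of_conductorNorm W hK hN hnt
    hp (by omega) hρ hM₀ hc hcc hx₀ hmax ?_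
    (@fun _ hM _ hℓ _ ↦ kolyvaginReciprocityFinset_of_poitouTate_of_conductorNorm W hN hPT hp hM hℓ)
    e hμ hadd₁ hadd₂ hgal halt hnondeg inv hPT' hinv hH3 hB hPτ
  intro M hM hdiv c₁ hc₁
  obtain ⟨ε, τ, hτ, A, hA, emb, Pt, hPt, hε, h53, hAτ, hPt1, hrat, hm'⟩ := hpointsR hM hdiv c₁ hc₁
  refine ⟨ε, τ, hτ, A, hA, Pt, hPt, hε, h53, hAτ, hPt1, fun m hm hk ↦ ⟨(hm' m hm hk).1, ?_, (hm' m hm hk).2⟩⟩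
  intro v hv
  exact kolyvaginClass_mem_selmerLocalKer_of_ringClassRational_of_isKolyvaginPrime hK ι (Squarefree.ne_zero hm)
    (emb m) W hN hp hp5 hin hsp hTam (fun q hq ↦ (hk q hq).1) (hA m) (hrat m (Squarefree.ne_zero hm)) (hPt m) v hv

/-- **S1 + S2 of item 19718 in INDEX form at `p ≥ 5`, `#Ш(E/K)[p^∞] ≤ p^(2·ord_p[E(K):ℤP])`, for a Heegner-type
Euler system rational over the ring class fields, from Poitou–Tate and the Cassels–Tate inputs** (binders as in the
previous theorem + `0 < [E(K):ℤP]`, `M₀ = padicValNat p [E(K):ℤP]` the level of the Cassels–Tate data). McCallum's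
Lemma 5.1 (tree `Additive.zsmul_certificate_of_padicValNat_index`, `E(K)[p] = 0` from `ρ̄_{E,p}` onto) gives
`p^{M₀} x₀ = P ∉ p^{M₀+1}E(K)`; `M₀ = 0` is shim-p1's `natCard_primaryComponent_sha_le_of_ringClassRationalPointsM_of_poitouTate`
(p471634), `M₀ ≥ 1` the previous theorem. HONEST: conditional on the carrier, `hPT`, `hTam`, the Cassels–Tate inputs;
items 19718 ∕ 19627 stay OPEN. [cite: McCallumLMS1991, §1 Theorem (Kolyvagin), Lemma 5.1, Cor. 5.6]
[cite: GrossLMS1991, §2 Prop. 2.1 (2), Thm. 2.2 (2)] [cite: Kim2022HigherGZ, §2.1 and Thm. 4.3] -/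
theorem natCard_sha_primary_le_pow_index_of_ringClassRationalPointsM_of_poitouTate_of_localDuality_of_five_le
    (hPT : poitouTate_sum_localTatePairing_eq_zero K)
    (W : WeierstrassCurve ℚ) [W.IsElliptic] [W.IsGloballyMinimal] {N : ℕ} [NeZero N]
    (hN : W.conductorNorm ℤ = N) {p : ℕ} [Fact p.Prime] (hp5 : 5 ≤ p) (hρ : W.HasSurjectiveModNGaloisRep p)
    (hK : IsImaginaryQuadratic K)
    (ι : K →+* ℂ) {S : Finset ℕ}
    (hin : ∀ ℓ ∈ S, ℓ.Prime ∧ ℓ ∣ N ∧ ¬ ℓ ^ 2 ∣ N ∧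
      ((Ideal.span {(ℓ : ℤ)}).primesOver (𝓞 K)).ncard = 1 ∧ ¬ (ℓ : ℤ) ∣ NumberField.discr K)
    (hsp : ∀ ℓ : ℕ, ℓ.Prime → ℓ ∣ N → ℓ ∉ S → ((Ideal.span {(ℓ : ℤ)}).primesOver (𝓞 K)).ncard = 2)
    (hTam : ∀ (ℓ : ℕ) [Fact ℓ.Prime], ℓ ∉ S → W.HasMultiplicativeReductionAtPrime ℓ →
      ¬ p ∣ padicValInt ℓ W.minimalDiscriminantInt)
    {P : (W.baseChange K).toAffine.Point} (hnt : ¬ IsOfFinAddOrder P)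
    (hidx0 : 0 < (AddSubgroup.zmultiples P).index) {M₀ : ℕ}
    (hv : padicValNat p (AddSubgroup.zmultiples P).index = M₀) [NeZero (p ^ M₀)]
    {c : K ≃ₐ[ℚ] K} (hc : c ≠ 1) (hcc : c * c = 1)
    (hpointsR : ∀ {M : ℕ} (_hM : 1 ≤ M)
      (hdiv : ∀ Q : geomPoints (W.baseChange K), ∃ R, ((p ^ M : ℕ) : ℤ) • R = Q)
      (c : K ≃ₐ[ℚ] K) (_hc : c ≠ 1),
      ∃ (ε : ℤ) (τ : AlgebraicClosure K ≃+* AlgebraicClosure K) (hτ : IsLiftOfAut c τ)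
        (A : ℕ → AddSubgroup (geomPoints (W.baseChange K)))
        (hA : ∀ m, KolyvaginCocycle.IsAdmissible (Field.absoluteGaloisGroup K) (A m)
          ((p ^ M : ℕ) : ℤ))
        (emb : ∀ m : ℕ, ringClassField K ι m →ₐ[K] AlgebraicClosure K)
        (Pt : ℕ → geomPoints (W.baseChange K))
        (hPt : ∀ m, Pt m ∈
          KolyvaginCocycle.invPoints (Field.absoluteGaloisGroup K) (A m) ((p ^ M : ℕ) : ℤ)),
        (ε = 1 ∨ ε = -1) ∧
        IsOfFinAddOrder (Affine.Point.map (W' := W) (c : K →ₐ[ℚ] K) P - ε • P) ∧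
        (∀ m, ∀ a ∈ A m, hτ.pointsMap W a ∈ A m) ∧
        Pt 1 = toGeomPoints (W.baseChange K) P ∧
        (∀ m, m ≠ 0 → ∀ a ∈ A m, ∀ Φ : Field.absoluteGaloisGroup K,
          (∀ x : ringClassField K ι m, Φ • emb m x = emb m x) → Φ • a = a) ∧
        (∀ m : ℕ, Squarefree m →
          (∀ q ∈ m.primeFactors, IsKolyvaginPrime N W K p q ∧ FrobEqFrobInfty W K (p ^ M) q) →
          (∃ B ∈ A m, hτ.pointsMap W (Pt m) =
            (ε * (-1) ^ m.primeFactors.card) • Pt m + ((p ^ M : ℕ) : ℤ) • B) ∧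
          (∀ ℓ : ℕ, ℓ.Prime → ℓ ∣ m → ∀ v : HeightOneSpectrum (𝓞 K), (ℓ : 𝓞 K) ∈ v.asIdeal →
            ∀ a : ℕ, (((p : ℤ) ^ a) •
                kolyvaginClass (W.baseChange K) _ hdiv (hA m) (Pt m) (hPt m) ∈
                selmerLocalKer (W.baseChange K) (v.adicCompletion K) ((p ^ M : ℕ) : ℤ) ↔
              ((p : ℤ) ^ a) • kolyvaginClass (W.baseChange K) _ hdiv (hA (m / ℓ)) (Pt (m / ℓ))
                  (hPt (m / ℓ)) ∈
                (W.baseChange K).torsionLocalKer (v.adicCompletion K) ((p ^ M : ℕ) : ℤ)))))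
    (e : geomTorsion (W.baseChange K) ((p ^ M₀ * p ^ M₀ : ℕ) : ℤ) →
      geomTorsion (W.baseChange K) ((p ^ M₀ * p ^ M₀ : ℕ) : ℤ) → AlgebraicClosure K)
    (hμ : ∀ S T, e S T ^ (p ^ M₀ * p ^ M₀) = 1)
    (hadd₁ : ∀ S₁ S₂ T, e (S₁ + S₂) T = e S₁ T * e S₂ T)
    (hadd₂ : ∀ S T₁ T₂, e S (T₁ + T₂) = e S T₁ * e S T₂)
    (hgal : ∀ (σ : absoluteGaloisGroup K) (S T : geomTorsion (W.baseChange K) ((p ^ M₀ * p ^ M₀ : ℕ) : ℤ)),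
      σ • e S T = e (σ • S) (σ • T))
    (halt : ∀ T, e T T = 1) (hnondeg : ∀ T, (∀ S, e S T = 1) → T = 0)
    (inv : LocalInvariants K (p ^ M₀ * p ^ M₀)) (hPT' : inv.SumInvLocalizationEqZero)
    (hinv : ∀ v : HeightOneSpectrum (𝓞 K), Injective (inv (Sum.inr v)))
    (hH3 : ∀ x : galoisCohomology (mu K (p ^ M₀ * p ^ M₀)) 3,
      (∀ v : Place K, galoisCohomology.localization (mu K (p ^ M₀ * p ^ M₀)) v 3 x = 0) → x = 0)
    (hB : Literature.GroupTheory.FiniteAbelian.IsLevelPairing (p ^ M₀)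
      (ctLevelPairing (W.baseChange K) (p ^ M₀) e hμ hadd₁ hadd₂ hgal inv halt hPT' hH3
        (localTerm_finite_support (W := W.baseChange K) (m := p ^ M₀) (e := e) (hμ := hμ)
          (hadd₁ := hadd₁) (hadd₂ := hadd₂) (hgal := hgal) halt inv)))
    (hPτ : ∀ z ∈ selmerGroup (W.baseChange K) ((p ^ M₀ * p ^ M₀ : ℕ) : ℤ),
      ∀ t ∈ selmerGroup (W.baseChange K) ((p ^ M₀ * p ^ M₀ : ℕ) : ℤ),
      ctGeneralFun (W.baseChange K) (p ^ M₀) e hμ hadd₁ hadd₂ hgal inv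
          (torsionH1ToH1 (W.baseChange K) _ (conjAct W c _ z))
          (torsionH1ToH1 (W.baseChange K) _ (conjAct W c _ t)) =
        ctGeneralFun (W.baseChange K) (p ^ M₀) e hμ hadd₁ hadd₂ hgal inv
          (torsionH1ToH1 (W.baseChange K) _ z) (torsionH1ToH1 (W.baseChange K) _ t)) :
    Nat.card (AddCommGroup.primaryComponent (W.baseChange K).sha p) ≤
      p ^ (2 * padicValNat p (AddSubgroup.zmultiples P).index) := by
  haveI : (W.baseChange K).IsElliptic := inferInstanceAs (W.map (algebraMap ℚ K)).IsElliptic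
  have hp : p.Prime := Fact.out
  rcases Nat.eq_zero_or_pos M₀ with h0 | hpos
  · subst h0
    exact natCard_primaryComponent_sha_le_of_ringClassRationalPointsM_of_poitouTate hPT W hN hp5 hρ hK ι hin hsp
      hTam hnt hidx0 hv hpointsR
  -- `E(K)[p] = 0`
  have hbot := torsionBy_eq_bot_of_isImaginaryQuadratic W K hK hp (by omega) hρ
  have hAp : ∀ a : (W.baseChange K).toAffine.Point, ((p : ℕ) : ℤ) • a = 0 → a = 0 := fun a ha ↦ by
    have : a ∈ AddSubgroup.torsionBy (W.baseChange K).toAffine.Point ((p : ℕ) : ℤ) := by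
      rw [mem_torsionBy_iff]; exact ha
    rw [hbot] at this
    exact this
  -- McCallum Lemma 5.1: `ord_p [E(K) : ℤP] = M₀ ⟺ p^{M₀} ∥ P`
  obtain ⟨⟨x₀, hx₀⟩, hmax'⟩ :=
    Summit.BirchSwinnertonDyer.Rank1Residual.Additive.zsmul_certificate_of_padicValNat_index hp hAp hnt hidx0.ne' hv
  have hx₀' : p ^ M₀ • x₀ = P := by rw [← natCast_zsmul]; exact hx₀
  have hmax : ∀ Q : (W.baseChange K).toAffine.Point, p ^ (M₀ + 1) • Q ≠ P := fun Q hQ ↦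
    hmax' ⟨Q, by rw [natCast_zsmul]; exact hQ⟩
  rw [hv]
  exact (card_sha_primary_le_of_ringClassRationalPointsM_of_poitouTate_of_localDuality_of_five_le hPT W hN hp5 hρ
    hK ι hin hsp hTam hnt hpos hc hcc hx₀' hmax hpointsR e hμ hadd₁ hadd₂ hgal halt hnondeg inv hPT' hinv hH3
    hB hPτ).2.2.1

end Summit.BirchSwinnertonDyer.BirchSwinnertonDyer.Theorems.ShimuraKolyvaginLocalShift
end
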